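import Summits.AtomisticToContinuum.BoseEinsteinCondensation.Theorems.CorrectorClosure.Negative.InsertionResidueOneExcitationState
import Summits.AtomisticToContinuum.BoseEinsteinCondensation.Theorems.CorrectorClosure.Negative.InsertionResidueHardCoreJamming
import Literature.MathematicalPhysics.QuantumManyBody.PeriodicBoseGasTagged
import Literature.MathematicalPhysics.QuantumManyBody.DyadicCoherentFractionRefinement

/-!
# Negative lemmas for crux `CorrectorClosure` (stmt-AtomisticToContinuum-12058), II-c:
tightness of the insertion overlap and the falsity of an `N`-uniform near-minimiser window

Supports stmt-AtomisticToContinuum-12058 (route `BECInsertionCorrector`).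

* `overlap_sq_le_taggedZeroModeOccupation`, `overlap_sq_le_one`,
  `succ_mul_overlap_sq_le_condensateOccupation` — Cauchy–Schwarz: the target quantity of
  `InsertionResidue` satisfies `L⁻³ |∫ conj Θ ∫_cell Ψ|² ≤ ⟨Ψ, P_{Ω,0}Ψ⟩ ≤ 1` and
  `(N+1)·(…) ≤ ⟨Ψ, n₀Ψ⟩` (so no version with `c > 1`; analytic core of support item 12059).
* `insertionResidue_false_uniformWindow` — `InsertionResidue` with the window `δ` chosen BEFORE
  `N` (`InsertionResidueUniformWindow`) is FALSE at `v = 0`: for every `Θ` the window contains,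
  once `(2π/L)² ≤ δ`, a state `(w₂ − w₁ N_k 1)/‖·‖` with zero insertion overlap
  (`exists_lowEnergy_zero_overlap`). The admissible `δ_N` in `InsertionResidue` is therefore below
  the first excitation energy of the `(N+1)`-body torus Hamiltonian (`4π²/L² ∼ N^{-2/3}` free,
  `c_s 2π/L ∼ N^{-1/3}` interacting): the quantifier order `∀ᶠ N, ∃ δ` is load-bearing.
-/

noncomputable section

open MeasureTheory Filter Metric WithLp
open scoped ENNReal NNReal ComplexConjugate BigOperators

namespace Summit.AtomisticToContinuum.BoseEinsteinCondensation.Theorems.CorrectorClosure.Negative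

open Literature.MathematicalPhysics.QuantumManyBody.BoseGas
open Summit.AtomisticToContinuum.BoseEinsteinCondensation.Theses.BECInsertionCorrector

/-! ## §5 Tightness: the insertion overlap is a probability (`c ≤ 1` is forced and attained) -/

/-- **Cauchy–Schwarz.** For normalised `Θ` (N bodies) and any `(N+1)`-body function,
`L⁻³ |∫ conj Θ(X) ∫_cell Ψ(x,X) dx dX|² ≤ ⟨Ψ, P_{Ω,0} Ψ⟩` (the tagged zero-mode occupation).
[folklore] -/
theorem overlap_sq_le_taggedZeroModeOccupation {N : ℕ} {L : ℝ} (hL : 0 < L)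
    (Θ : PeriodicTrialState N L) (Ψ : PeriodicTrialState (N + 1) L) :
    ENNReal.ofReal ((L ^ 3)⁻¹) *
      (‖∫ X in cellN N L, conj (Θ.ψ X) * ∫ x in cell L, Ψ.ψ (Matrix.vecCons x X)‖₊ : ℝ≥0∞) ^ 2
      ≤ taggedZeroModeOccupation N L Ψ.ψ := by
  set g : Config N → ℂ := fun X => ∫ x in cell L, Ψ.ψ (Matrix.vecCons x X) with hg_def
  have hg : Measurable g := measurable_setIntegral_vecCons Ψ.contDiff.continuous.measurable _
  have hΘ : Measurable Θ.ψ := Θ.contDiff.continuous.measurable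
  have hCS := sq_nnnorm_integral_mul_conj_le (ν := volume.restrict (cellN N L)) (f := g)
    (g := Θ.ψ) hg.aemeasurable hΘ.aemeasurable
  rw [Θ.norm_eq, mul_one] at hCS
  have hcomm : (∫ X in cellN N L, conj (Θ.ψ X) * g X) = ∫ X in cellN N L, g X * conj (Θ.ψ X) := by
    congr 1; funext X; ring
  rw [hcomm, ENNReal.ofReal_inv_of_pos (by positivity), ENNReal.ofReal_pow hL.le]
  unfold taggedZeroModeOccupation
  gcongr

/-- Hence `L⁻³ |overlap|² ≤ 1`: no version of the target with a constant `c > 1` can hold, and the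
insertion overlap is a genuine probability. [folklore] -/
theorem overlap_sq_le_one {N : ℕ} {L : ℝ} (hL : 0 < L)
    (Θ : PeriodicTrialState N L) (Ψ : PeriodicTrialState (N + 1) L) :
    ENNReal.ofReal ((L ^ 3)⁻¹) *
      (‖∫ X in cellN N L, conj (Θ.ψ X) * ∫ x in cell L, Ψ.ψ (Matrix.vecCons x X)‖₊ : ℝ≥0∞) ^ 2
      ≤ 1 := by
  refine (overlap_sq_le_taggedZeroModeOccupation hL Θ Ψ).trans ?_
  have h := Ψ.toTagged.taggedZeroModeOccupation_le_one
  rwa [PeriodicTrialState.toTagged_ψ] at h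

/-- **The analytic core of `ResidueCondenses` (item 12059)**: `(N+1) L⁻³ |overlap|² ≤ ⟨Ψ, n₀ Ψ⟩`,
so an insertion residue `≥ c` forces `condensateOccupation ≥ c (N+1)`. [folklore] -/
theorem succ_mul_overlap_sq_le_condensateOccupation {N : ℕ} {L : ℝ} (hL : 0 < L)
    (Θ : PeriodicTrialState N L) (Ψ : PeriodicTrialState (N + 1) L) :
    (N + 1 : ℝ≥0∞) * (ENNReal.ofReal ((L ^ 3)⁻¹) *
      (‖∫ X in cellN N L, conj (Θ.ψ X) * ∫ x in cell L, Ψ.ψ (Matrix.vecCons x X)‖₊ : ℝ≥0∞) ^ 2)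
      ≤ condensateOccupation (N + 1) L Ψ.ψ := by
  rw [← succ_mul_taggedZeroModeOccupation hL Ψ.ψ]
  gcongr
  exact overlap_sq_le_taggedZeroModeOccupation hL Θ Ψ

/-! ## §7 Quantifier order: the energy window must shrink with `N` -/

/-- `InsertionResidue` with the window `δ` chosen BEFORE `N` (`∃ δ, ∀ᶠ N` instead of
`∀ᶠ N, ∃ δ`; everything else verbatim): an `N`-uniform near-minimiser window. -/
def InsertionResidueUniformWindow : Prop :=
  ∀ v : ℝ → ENNReal, IsRepulsiveFiniteRange v → ∃ ρ₀ : ℝ, 0 < ρ₀ ∧ ∀ ρ : ℝ, 0 < ρ → ρ < ρ₀ →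
    ∃ c : ℝ, 0 < c ∧ ∃ δ : ENNReal, 0 < δ ∧ ∀ᶠ N : ℕ in Filter.atTop,
      ∃ Θ : PeriodicTrialState N (sideLength ρ (N + 1)),
        periodicEnergy v Θ ≤ periodicGroundStateEnergy v N (sideLength ρ (N + 1)) + δ ∧
        ∀ Ψ : PeriodicTrialState (N + 1) (sideLength ρ (N + 1)),
          periodicEnergy v Ψ ≤ periodicGroundStateEnergy v (N + 1) (sideLength ρ (N + 1)) + δ →
          ENNReal.ofReal c ≤ ENNReal.ofReal ((sideLength ρ (N + 1) ^ 3)⁻¹) *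
            (‖∫ X in cellN N (sideLength ρ (N + 1)), conj (Θ.ψ X) *
                ∫ x in cell (sideLength ρ (N + 1)), Ψ.ψ (Matrix.vecCons x X)‖₊ : ENNReal) ^ 2

/-- **The one-excitation energy `(2π/L)²` eventually fits in any fixed window.** [folklore] -/
theorem exists_window_threshold {ρ d : ℝ} (hρ : 0 < ρ) (hd : 0 < d) :
    ∃ N₀ : ℕ, ∀ N : ℕ, N₀ ≤ N → (2 * Real.pi / sideLength ρ (N + 1)) ^ 2 ≤ d := by
  set K : ℝ := max 1 (4 * Real.pi ^ 2 / d) with hK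
  refine ⟨⌈ρ * K ^ 3⌉₊, fun N hN => ?_⟩
  have hL := sideLength_succ_pos hρ N
  set L := sideLength ρ (N + 1) with hLdef
  have hL3 : L ^ 3 = ((N : ℝ) + 1) / ρ := sideLength_succ_pow_three hρ N
  have hK1 : 1 ≤ K := le_max_left _ _
  have hKd : 4 * Real.pi ^ 2 / d ≤ K := le_max_right _ _
  have hK0 : 0 ≤ K := zero_le_one.trans hK1
  have hNK : ρ * K ^ 3 ≤ (N : ℝ) + 1 := by
    have h1 : ρ * K ^ 3 ≤ ⌈ρ * K ^ 3⌉₊ := Nat.le_ceil _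
    have h2 : (⌈ρ * K ^ 3⌉₊ : ℝ) ≤ N := by exact_mod_cast hN
    linarith
  have hLK3 : K ^ 3 ≤ L ^ 3 := by
    rw [hL3, le_div_iff₀ hρ]
    linarith [mul_comm ρ (K ^ 3)]
  have hLK : K ≤ L := le_of_pow_le_pow_left₀ (by norm_num) hL.le hLK3
  have hL1 : 1 ≤ L := hK1.trans hLK
  have hdL : 4 * Real.pi ^ 2 ≤ d * L := by
    have := hKd.trans hLK
    rw [div_le_iff₀ hd] at this
    linarith
  rw [div_pow, div_le_iff₀ (by positivity)]
  nlinarith [hdL, hL1, hd.le, mul_le_mul_of_nonneg_left hL1 hd.le]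

/-- **For every `Θ` there is a free `(N+1)`-body state within ONE excitation quantum of the ground
state and with ZERO insertion overlap** (the linear form `Ψ ↦ ⟨φ₀ ⊗ Θ, Ψ⟩` has a kernel meeting
the plane spanned by the condensate `1` and the one-phonon state `N_k 1`, `k = 2π e₀/L`). [folklore] -/
theorem exists_lowEnergy_zero_overlap {N : ℕ} {L : ℝ} (hL : 0 < L) (Θ : Config N → ℂ)
    (hΘ : Continuous Θ) :
    ∃ Ψ : PeriodicTrialState (N + 1) L,
      periodicEnergy 0 Ψ ≤ ENNReal.ofReal ((2 * Real.pi / L) ^ 2) ∧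
      ∫ Y in cellN N L, conj (Θ Y) * ∫ x in cell L, Ψ.ψ (Matrix.vecCons x Y) = 0 := by
  set w₁ : ℂ := ∫ Y in cellN N L, conj (Θ Y) with hw₁
  set w₂ : ℂ := ∫ Y in cellN N L, conj (Θ Y) * planeWaveSum L e0 Y with hw₂
  by_cases hw : w₁ = 0
  · have hab : (1 : ℂ) ≠ 0 ∨ (0 : ℂ) ≠ 0 := Or.inl one_ne_zero
    refine ⟨affineState hL (Nat.succ_pos N) e0_ne_zero hab, ?_, ?_⟩
    · exact (periodicEnergy_zero_affineState_le hL _ e0_ne_zero hab).trans_eq (by rw [momSq_e0])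
    · rw [overlap_affineState hL e0_ne_zero hab Θ hΘ, ← hw₁, hw]
      ring
  · have hab : w₂ ≠ 0 ∨ -w₁ ≠ 0 := Or.inr (neg_ne_zero.2 hw)
    refine ⟨affineState hL (Nat.succ_pos N) e0_ne_zero hab, ?_, ?_⟩
    · exact (periodicEnergy_zero_affineState_le hL _ e0_ne_zero hab).trans_eq (by rw [momSq_e0])
    · rw [overlap_affineState hL e0_ne_zero hab Θ hΘ, ← hw₁, ← hw₂]
      ring

/-- **Per-box form of the obstruction**: at `v = 0`, as soon as the window `δ` is at least ONE
excitation quantum `(2π/L)²`, every `Θ` admits a `δ`-near-minimiser of the `(N+1)`-body problem with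
ZERO insertion overlap. So in `InsertionResidue` at `v = 0` necessarily `δ_N < (2π/L_N)² = 4π² (ρ/(N+1))^{2/3}`.
[folklore] -/
theorem exists_nearMinimiser_zero_overlap_of_gap_le_window {N : ℕ} {L : ℝ} (hL : 0 < L)
    {δ : ℝ≥0∞} (hδ : ENNReal.ofReal ((2 * Real.pi / L) ^ 2) ≤ δ) (Θ : Config N → ℂ)
    (hΘ : Continuous Θ) :
    ∃ Ψ : PeriodicTrialState (N + 1) L,
      periodicEnergy 0 Ψ ≤ periodicGroundStateEnergy 0 (N + 1) L + δ ∧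
      ∫ Y in cellN N L, conj (Θ Y) * ∫ x in cell L, Ψ.ψ (Matrix.vecCons x Y) = 0 := by
  obtain ⟨Ψ, hE, hO⟩ := exists_lowEnergy_zero_overlap hL Θ hΘ
  exact ⟨Ψ, (hE.trans hδ).trans le_add_self, hO⟩

/-- **The `N`-uniform window is FALSE** (at `v = 0`, every density): however small `δ > 0` is,
once `(2π/L)² ≤ δ` (i.e. `N + 1 ≥ ρ (2π)³ δ^{-3/2}`) the window contains, for every `Θ`, a state
with zero insertion overlap. Consequently in `InsertionResidue` the admissible `δ_N` is at most
the first excitation energy of the `(N+1)`-body torus Hamiltonian (free: `4π²/L² ∼ N^{-2/3}`;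
interacting: the phonon `c_s 2π/L ∼ N^{-1/3}`), and any proof must use `δ`'s dependence on `N`.
[folklore] -/
theorem insertionResidue_false_uniformWindow : ¬ InsertionResidueUniformWindow := by
  intro h
  obtain ⟨ρ₀, hρ₀, h⟩ := h 0 isRepulsiveFiniteRange_zero
  have hρ : (0 : ℝ) < ρ₀ / 2 := by positivity
  obtain ⟨c, hc, δ, hδ, hev⟩ := h (ρ₀ / 2) hρ (by linarith)
  obtain ⟨N₀, hN₀⟩ : ∃ N₀ : ℕ, ∀ N : ℕ, N₀ ≤ N →
      ENNReal.ofReal ((2 * Real.pi / sideLength (ρ₀ / 2) (N + 1)) ^ 2) ≤ δ := by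
    by_cases htop : δ = ⊤
    · exact ⟨0, fun N _ => htop ▸ le_top⟩
    · obtain ⟨N₀, hN₀⟩ := exists_window_threshold hρ (ENNReal.toReal_pos hδ.ne' htop)
      exact ⟨N₀, fun N hN => (ENNReal.ofReal_le_ofReal (hN₀ N hN)).trans ENNReal.ofReal_toReal_le⟩
  obtain ⟨N, ⟨Θ, _hΘ, H⟩, hN⟩ := (hev.and (Filter.eventually_ge_atTop N₀)).exists
  have hL := sideLength_succ_pos hρ N
  obtain ⟨Ψ, hE, hO⟩ := exists_lowEnergy_zero_overlap hL Θ.ψ Θ.contDiff.continuous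
  have hwin : periodicEnergy 0 Ψ ≤
      periodicGroundStateEnergy 0 (N + 1) (sideLength (ρ₀ / 2) (N + 1)) + δ :=
    (hE.trans (hN₀ N hN)).trans le_add_self
  have h := H Ψ hwin
  rw [hO] at h
  simp only [nnnorm_zero, ENNReal.coe_zero, ne_eq, OfNat.ofNat_ne_zero, not_false_eq_true,
    zero_pow, mul_zero, nonpos_iff_eq_zero, ENNReal.ofReal_eq_zero] at h
  linarith


end Summit.AtomisticToContinuum.BoseEinsteinCondensation.Theorems.CorrectorClosure.Negative

end
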